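import Mathlib
import HarnessLib.Audit
import Summits.PneNP.PneNP.Theorems.PstarNorDataTools

/-!
# Expansion counts for the NOR-core accounting lemma, generic form (ROUND-24, GAPTWO-PLAN v1 S4c)

FRONTIER range-avoidance ladder, rung F-N3, ROUND 24 (cell `pnp-ideate`; restricted-model proof complexity — nothing here bears
on `P` versus `NP`).

The two whole-family boundary-expansion counts used in the proof of the NOR-core accounting lemma (memo `CORE-BOUND-NOTES.md`
§5) for generic NOR data `CoreData I J₀ C σ τ g₀` (`PstarNorDataTools`):

* `global_count` — family `J₀ ∪ {g₀}` under `XorClosed`: `3(#J₀ + 1) + 2(δσ + δτ) ≤ 2(#C + 2#(J₀ ∖ C) + 4)`, where `δσ = 1` is allowed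
  when some output of `J₀` reads `σ` (then `σ` is not private next to the reader `g₀`), likewise `δτ`; with both read this is the
  memo's `#centre ≤ #chords + 1`;
* `cen_count` — family `C` (the centre edges): `3#C ≤ 2(η + #C + [σ ∈ bdry C] + [τ ∈ bdry C])`, `η` the number of XOR
  variables of centre degree one.
-/

set_option linter.dupNamespace false

open Finset Literature.Computability.Complexity
open Summit.PneNP.PneNP.Theorems.PstarSALevel (varSet bdry BoundaryExpanding SimpleOverlap)
open Summit.PneNP.PneNP.Theorems.PstarGapLinearised (andPair andPair_subset_varSet)
open Summit.PneNP.PneNP.Theorems.PstarCentreFree (vars_mem_varSet)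
open Summit.PneNP.PneNP.Theorems.PstarGapOneKills (exists_other_reader mem_andPair_of_slot)
open Summit.PneNP.PneNP.Theorems.PstarCoreBound (XorClosed)
open Summit.PneNP.PneNP.Theorems.PstarNorCoreTools (not_mem_bdry_of_two card_varSet_inter_bdry_le card_bdry_le_sum eq_of_mem_bdry xorPair
  mem_xorPair_iff xorPair_subset_varSet oth)
open Summit.PneNP.PneNP.Theorems.PstarNorDataTools

namespace Summit.PneNP.PneNP.Theorems.PstarNorDataCounts

variable {n m : ℕ}

section Nor

variable {I : LocalMap 4 n m} {J₀ C : Finset (Fin m)}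
variable {σ τ : Fin n} {g₀ : Fin m} (hN : CoreData I J₀ C σ τ g₀)


/-- Under `XorClosed`, an XOR-slot variable of an output of `J₀` is read by another output of `J₀`, hence is private in no
family between `J₀` and a superset. -/
theorem xor_not_mem_bdry (hx : XorClosed I J₀) {X : Finset (Fin m)} (hX : J₀ ⊆ X) {f : Fin m} (hf : f ∈ J₀) (s : Fin 4)
    (hs : s.val < 2) : I.vars f s ∉ bdry I X := by
  obtain ⟨g, hg, hne, hv⟩ := exists_other_reader I hf (vars_mem_varSet I f s) (hx f hf s hs)
  exact not_mem_bdry_of_two I (hX hf) (hX hg) hne.symm (vars_mem_varSet I f s) hv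

include hN in
/-- **Global count** (family `J₀ ∪ {g₀}`, `XorClosed`): `3(#J₀ + 1) ≤ 2(#cen + 2#chd + 4 - δσ - δτ)` where `δσ = 1` if some
output of `J₀` reads `σ` (then `σ` is not private next to `g₀`), and likewise `δτ`. -/
theorem global_count {r : ℕ} (hB : BoundaryExpanding r I) (hk : J₀.card < r) (hx : XorClosed I J₀) (δσ δτ : ℕ)
    (hδσ : δσ ≤ 1) (hδτ : δτ ≤ 1) (hσ : δσ = 1 → ∃ f ∈ J₀, σ ∈ varSet I f) (hτ : δτ = 1 → ∃ f ∈ J₀, τ ∈ varSet I f) :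
    3 * (J₀.card + 1) + 2 * (δσ + δτ) ≤ 2 * ((C).card + 2 * ((J₀ \ C)).card + 4) := by
  classical
  have hg₀ : g₀ ∉ J₀ := hN.2.2.1
  set X := insert g₀ J₀ with hXdef
  have hXc : X.card = J₀.card + 1 := card_insert_of_notMem hg₀
  have hJX : J₀ ⊆ X := subset_insert _ _
  have hgX : g₀ ∈ X := mem_insert_self _ _
  have hexp := hB X (by omega)
  -- per-output bounds
  let q : Fin m → ℕ := fun j => if j = g₀ then 4 - (δσ + δτ) else if j ∈ C then 1 else 2
  have hq : ∀ j ∈ X, (varSet I j ∩ bdry I X).card ≤ q j := by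
    intro j hj
    rcases mem_insert.1 hj with rfl | hjJ
    · -- the reader `g₀`: the slots of `σ` / `τ` are non-private when read in `J₀`
      simp only [q, if_true]
      obtain ⟨sσ, hsσ⟩ : ∃ s : Fin 4, I.vars j s = σ := by
        rcases hN.2.2.2.1 with ⟨h, -⟩ | ⟨-, h⟩
        · exact ⟨2, h⟩
        · exact ⟨3, h⟩
      obtain ⟨sτ, hsτ⟩ : ∃ s : Fin 4, I.vars j s = τ := by
        rcases hN.2.2.2.1 with ⟨-, h⟩ | ⟨h, -⟩
        · exact ⟨3, h⟩
        · exact ⟨2, h⟩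
      have hst : sσ ≠ sτ := fun h => hN.2.1 (by rw [← hsσ, ← hsτ, h])
      let N : Finset (Fin 4) := (if δσ = 1 then {sσ} else ∅) ∪ (if δτ = 1 then {sτ} else ∅)
      have hN' : ∀ s ∈ N, I.vars j s ∉ bdry I X := by
        intro s hs
        simp only [N, mem_union] at hs
        rcases hs with hs | hs
        · split_ifs at hs with h
          · rw [mem_singleton] at hs
            obtain ⟨f, hf, hσf⟩ := hσ h
            have hne : j ≠ f := by rintro rfl; exact hg₀ hf
            rw [hs, hsσ]
            exact not_mem_bdry_of_two I hgX (hJX hf) hne (hsσ ▸ vars_mem_varSet I j sσ) hσf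
          · simp at hs
        · split_ifs at hs with h
          · rw [mem_singleton] at hs
            obtain ⟨f, hf, hτf⟩ := hτ h
            have hne : j ≠ f := by rintro rfl; exact hg₀ hf
            rw [hs, hsτ]
            exact not_mem_bdry_of_two I hgX (hJX hf) hne (hsτ ▸ vars_mem_varSet I j sτ) hτf
          · simp at hs
      have hNc : N.card = δσ + δτ := by
        simp only [N]
        have h1 : δσ = 0 ∨ δσ = 1 := by omega
        have h2 : δτ = 0 ∨ δτ = 1 := by omega
        rcases h1 with h1 | h1 <;> rcases h2 with h2 | h2 <;> simp [h1, h2, hst]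
      exact hNc ▸ card_varSet_inter_bdry_le I X j N hN'
    · have hjg : j ≠ g₀ := by rintro rfl; exact hg₀ hjJ
      simp only [q, if_neg hjg]
      by_cases hjc : j ∈ C
      swap
      · rw [if_neg hjc]
        have := card_varSet_inter_bdry_le I X j {0, 1} fun s hs => by
          rw [mem_insert, mem_singleton] at hs
          rcases hs with rfl | rfl
          · exact xor_not_mem_bdry hx hJX hjJ 0 (by decide)
          · exact xor_not_mem_bdry hx hJX hjJ 1 (by decide)
        simpa using this
      · rw [if_pos hjc]
        -- a centre edge: both XOR slots and the class slot are non-private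
        obtain ⟨sρ, hsρ2, hsρ⟩ : ∃ s : Fin 4, 2 ≤ s.val ∧ (I.vars j s = σ ∨ I.vars j s = τ) := by
          rcases hN.2.2.2.2.1 j hjc with h | h | h | h
          · exact ⟨2, by decide, Or.inl h⟩
          · exact ⟨2, by decide, Or.inr h⟩
          · exact ⟨3, by decide, Or.inl h⟩
          · exact ⟨3, by decide, Or.inr h⟩
        have hσ₀ := sigma_mem_reader hN
        have hτ₀ := tau_mem_reader hN
        have hρb : I.vars j sρ ∉ bdry I X := by
          rcases hsρ with h | h
          · rw [h]; exact not_mem_bdry_of_two I (hJX hjJ) hgX hjg (h ▸ vars_mem_varSet I j sρ) hσ₀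
          · rw [h]; exact not_mem_bdry_of_two I (hJX hjJ) hgX hjg (h ▸ vars_mem_varSet I j sρ) hτ₀
        have h0 : (0 : Fin 4) ≠ sρ := fun h => by rw [← h] at hsρ2; exact absurd hsρ2 (by decide)
        have h1 : (1 : Fin 4) ≠ sρ := fun h => by rw [← h] at hsρ2; exact absurd hsρ2 (by decide)
        have := card_varSet_inter_bdry_le I X j {0, 1, sρ} fun s hs => by
          simp only [mem_insert, mem_singleton] at hs
          rcases hs with rfl | rfl | rfl
          · exact xor_not_mem_bdry hx hJX hjJ 0 (by decide)
          · exact xor_not_mem_bdry hx hJX hjJ 1 (by decide)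
          · exact hρb
        have hcard : ({0, 1, sρ} : Finset (Fin 4)).card = 3 := by
          rw [card_insert_of_notMem, card_pair h1]
          simp only [mem_insert, mem_singleton, not_or]
          exact ⟨by decide, h0⟩
        rw [hcard] at this
        simpa using this
  have hsum := card_bdry_le_sum I X q hq
  have hqsum : ∑ j ∈ X, q j = (4 - (δσ + δτ)) + ((C).card + 2 * ((J₀ \ C)).card) := by
    rw [hXdef, sum_insert hg₀]
    simp only [q, if_true]
    congr 1
    rw [sum_congr rfl fun j hj => if_neg (by rintro rfl; exact hg₀ hj)]
    rw [sum_ite, sum_const, sum_const, smul_eq_mul, smul_eq_mul, filter_mem_eq_inter, inter_eq_right.2 hN.1, mul_one]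
    have : J₀.filter (fun j => j ∉ C) = J₀ \ C := by ext j; simp [mem_sdiff]
    rw [this]
    ring
  rw [hqsum] at hsum
  rw [hXc] at hexp
  omega

include hN in
/-- **Centre count** (family `cen`): `3#cen ≤ 2(η + #cen + [σ ∈ bdry cen] + [τ ∈ bdry cen])`. -/
theorem cen_count {r : ℕ} (hB : BoundaryExpanding r I) (hk : J₀.card < r) :
    3 * (C).card ≤ 2 * ((univ.filter fun v => cdeg I C v = 1).card + (C).card +
      (if σ ∈ bdry I (C) then 1 else 0) + (if τ ∈ bdry I (C) then 1 else 0)) := by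
  classical
  set C := C with hC
  have hexp := hB C ((card_le_card hN.1).trans hk.le)
  -- the boundary of `cen` is covered by: degree-one XOR variables, fourth variables, and possibly `σ`, `τ`
  have hcov : bdry I C ⊆ (univ.filter fun v => cdeg I C v = 1) ∪ C.image (oth I σ τ) ∪
      (({σ, τ} : Finset (Fin n)).filter fun v => v ∈ bdry I C) := by
    intro v hv
    have hv' := hv
    unfold PstarSALevel.bdry at hv'
    rw [mem_filter, card_eq_one] at hv'
    obtain ⟨f, hf⟩ := hv'.2
    have hfm : f ∈ C.filter fun j => v ∈ varSet I j := by rw [hf]; exact mem_singleton_self f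
    rw [mem_filter] at hfm
    obtain ⟨hfC, hvf⟩ := hfm
    unfold PstarSALevel.varSet at hvf
    obtain ⟨s, -, hsv⟩ := mem_image.1 hvf
    rw [mem_union, mem_union]
    by_cases hs : s.val < 2
    · -- an XOR slot: then `v` has centre degree one
      left; left
      rw [mem_filter]
      refine ⟨mem_univ _, ?_⟩
      have hvx : v ∈ xorPair I f := by
        rw [mem_xorPair_iff]
        fin_cases s
        · exact Or.inl hsv.symm
        · exact Or.inr hsv.symm
        · exact absurd hs (by decide)
        · exact absurd hs (by decide)
      unfold cdeg
      rw [card_eq_one]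
      refine ⟨f, eq_singleton_iff_unique_mem.2 ⟨mem_filter.2 ⟨hfC, hvx⟩, fun f' hf' => ?_⟩⟩
      rw [mem_filter] at hf'
      exact (eq_of_mem_bdry I hfC hf'.1 hv (xorPair_subset_varSet I f hvx) (xorPair_subset_varSet I f' hf'.2)).symm
    · push Not at hs
      have hva : v ∈ andPair I f := hsv ▸ mem_andPair_of_slot I f s hs
      have := andPair_subset_oth hN hfC hva
      simp only [mem_insert, mem_singleton] at this
      rcases this with rfl | rfl | h
      · right; exact mem_filter.2 ⟨mem_insert_self _ _, hv⟩
      · right; exact mem_filter.2 ⟨mem_insert_of_mem (mem_singleton_self _), hv⟩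
      · left; right; exact mem_image.2 ⟨f, hfC, h.symm⟩
  have h1 := (card_le_card hcov).trans ((card_union_le _ _).trans (Nat.add_le_add_right (card_union_le _ _) _))
  have h2 : (C.image (oth I σ τ)).card ≤ C.card := card_image_le
  have h3 : ((({σ, τ} : Finset (Fin n)).filter fun v => v ∈ bdry I C)).card ≤
      (if σ ∈ bdry I C then 1 else 0) + (if τ ∈ bdry I C then 1 else 0) := by
    rw [filter_insert, filter_singleton]
    by_cases hσ : σ ∈ bdry I C <;> by_cases hτ : τ ∈ bdry I C <;> simp [hσ, hτ]
    exact (card_insert_le _ _).trans (by simp)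
  omega

end Nor

end Summit.PneNP.PneNP.Theorems.PstarNorDataCounts
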